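import Summits.FinalStateConjecture.FinalStateConjecture.Theorems.StarvedNecksGapDecaySufficesRelabelChartTransfer
import Summits.FinalStateConjecture.FinalStateConjecture.Theorems.GapDecaySuffices.Negative.RelabelDecomposition

/-!
# Route StarvedNecks — crux `GapDecaySuffices` (stmt-FinalStateConjecture-18060), line `Sketch`:
# the parity-relabelled decomposition `relabelEach d P` (per-label reflections, flat chart untouched)

Given a `Cᵏ` final-state decomposition `d` and a parity datum `P i : ParityDatum (Λᵢ)` for EVERY label
(file 1/3; `oneDatum` = keep, `holeDatum` = reflect), `relabelEach d P` is the decomposition with labels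
`(Λᵢ Qᵢ, cᵢ)`, hole charts `Ψᵢ ∘ Q̃ᵢ`, and the SAME masses, spins, `τ₀`, excisions, flat domain and flat chart
(unlike the disprover's `Negative.Relabel.relabel d Δ`, which moves all labels by ONE model Poincaré map).
Every label keeps its clock, radius, exterior and the images of all `(tᵢ, rᵢ, x⁰)`-defined sets; hence
`charted`, `region`, `radiationZone` are unchanged and `HonestCoreOf` (`Hc`), `DistinctLabels` (DV), the
flat clauses `Hf`(1)(2) and single-label gap certificates (verbatim the skeleton's `GapCertificateAt`)
transfer.  CAVEAT (`honestFar_relabelEach`): `Hf`(3) of label `i` transfers only from a bound on the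
`Q̃ᵢ`-REFLECTED honest cell `Q̃ᵢ {R₀ ≤ rᵢ ≤ rⱼ ∀ j ≠ i}`, which is not the honest cell when `d.N ≥ 2` (`Q̃ᵢ`
moves the other holes' lines): per-label parity relabelling does NOT preserve `Hf`(3) in general; it does
for `d.N = 1` (`honestFar_relabelEach_of_N_eq_one`).
Mathlib + files (1/3), (3/3) + `…Negative.RelabelDecomposition` (bundles `HonestCoreOf`, `HonestFarOf`,
`DistinctLabels`); no named facts, no `sorry`.  References: O'Neill 1983, Ch. 9; DHRT arXiv:2104.08222 §1.
-/

noncomputable section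

open scoped Manifold ContDiff Topology ENNReal
open Filter Set Function Topology Literature.Geometry.Lorentzian

namespace Summit.FinalStateConjecture.FinalStateConjecture.Theorems.GapDecaySuffices.Relabel

set_option linter.dupNamespace false

open Summit.FinalStateConjecture.FinalStateConjecture.Theorems.GapDecaySuffices.Negative.Relabel
  (HonestCoreOf HonestFarOf DistinctLabels)

section Decomposition

variable {𝓢 : Spacetime.{0} 4} {O : Set 𝓢.carrier} {k : ℕ}
variable (d : FinalStateDecomposition 𝓢 O k) (P : ∀ i : Fin d.N, ParityDatum (d.motion i).1)

/-- **The parity-relabelled decomposition `relabelEach d P`**: labels `(Λᵢ Qᵢ, cᵢ)`, hole charts `Ψᵢ ∘ Q̃ᵢ`,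
everything else unchanged.  Same region `O`, same regularity `k`. [folklore] -/
def relabelEach : FinalStateDecomposition 𝓢 O k where
  N := d.N
  mass := d.mass
  spin := d.spin
  mass_pos := d.mass_pos
  abs_spin_le_mass := d.abs_spin_le_mass
  motion i := (relabelMotion (P i), (d.motion i).2)
  τ₀ := d.τ₀
  chart i := relabelChart (P i) (d.motion i).2 (d.mass i) (d.spin i) (d.chart i)
  isLateChart i := isLateChart_relabelChart (P i) _ _ _ (d.chart i) (d.isLateChart i)
  tendsto_truncDeviationCk i R := by
    refine (d.tendsto_truncDeviationCk i R).congr fun τ ↦ ?_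
    exact (truncDeviationCk_relabelChart (P i) _ _ _ (d.chart i) (d.isLateChart i).contMDiff k R τ).symm
  exists_pairwise_disjoint R := by
    obtain ⟨τ₁, h⟩ := d.exists_pairwise_disjoint R
    refine ⟨τ₁, fun i j hij ↦ ?_⟩
    have := h hij
    simp only [Function.onFun] at this
    show Disjoint (relabelChart (P i) (d.motion i).2 (d.mass i) (d.spin i) (d.chart i) ''
        (boostedKerrBackground (relabelMotion (P i)) (d.motion i).2 (d.mass i) (d.spin i)).truncLateRegion τ₁ R)
      (relabelChart (P j) (d.motion j).2 (d.mass j) (d.spin j) (d.chart j) ''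
        (boostedKerrBackground (relabelMotion (P j)) (d.motion j).2 (d.mass j) (d.spin j)).truncLateRegion τ₁ R)
    rw [image_relabelChart_truncLateRegion, image_relabelChart_truncLateRegion]
    exact this
  excision := d.excision
  tendsto_excision_div := d.tendsto_excision_div
  flatDomain := d.flatDomain
  setOf_lt_excision_subset_flatDomain := by
    rintro x ⟨hx0, hx⟩
    refine d.setOf_lt_excision_subset_flatDomain ⟨hx0, fun j ↦ ?_⟩
    have h : d.excision j (x 0) < Kerr.radius (d.spin j) (poincareInv (relabelMotion (P j)) (d.motion j).2 x) :=
      hx j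
    rwa [poincareInv_relabelMotion, (P j).kerr_radius_map] at h
  flatChart := d.flatChart
  isLateChart_flat := d.isLateChart_flat
  tendsto_deviationCk_flat := d.tendsto_deviationCk_flat
  diff_subset_causalPast := by
    have e1 : ∀ i, relabelChart (P i) (d.motion i).2 (d.mass i) (d.spin i) (d.chart i) ''
        (boostedKerrBackground (relabelMotion (P i)) (d.motion i).2 (d.mass i) (d.spin i)).lateRegion d.τ₀ =
        d.chart i '' (d.background i).lateRegion d.τ₀ := fun i ↦
      image_relabelChart_lateRegion _ _ _ _ (d.chart i) d.τ₀
    have e2 : ∀ i, relabelChart (P i) (d.motion i).2 (d.mass i) (d.spin i) (d.chart i) ''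
        (boostedKerrBackground (relabelMotion (P i)) (d.motion i).2 (d.mass i) (d.spin i)).timeSlab d.τ₀ =
        d.chart i '' (d.background i).timeSlab d.τ₀ := fun i ↦
      image_relabelChart_timeSlab _ _ _ _ (d.chart i) d.τ₀
    show O \ ((⋃ i, relabelChart (P i) (d.motion i).2 (d.mass i) (d.spin i) (d.chart i) ''
        (boostedKerrBackground (relabelMotion (P i)) (d.motion i).2 (d.mass i) (d.spin i)).lateRegion d.τ₀) ∪
        d.flatChart '' (Minkowski.backgroundOn d.flatDomain).lateRegion d.τ₀) ⊆
      𝓢.metric.causalPast 𝓢.timeOrientation ((⋃ i, relabelChart (P i) (d.motion i).2 (d.mass i) (d.spin i)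
        (d.chart i) '' (boostedKerrBackground (relabelMotion (P i)) (d.motion i).2 (d.mass i)
          (d.spin i)).timeSlab d.τ₀) ∪ d.flatChart '' (Minkowski.backgroundOn d.flatDomain).timeSlab d.τ₀)
    simp only [e1, e2]
    exact d.diff_subset_causalPast

/-- Same number of holes. [folklore] -/
@[simp] theorem relabelEach_N : (relabelEach d P).N = d.N := rfl

/-- Same masses. [folklore] -/
@[simp] theorem relabelEach_mass : (relabelEach d P).mass = d.mass := rfl

/-- Same spins. [folklore] -/
@[simp] theorem relabelEach_spin : (relabelEach d P).spin = d.spin := rfl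

/-- The relabelled motion of label `i` is `(Λᵢ Qᵢ, cᵢ)`. [folklore] -/
theorem relabelEach_motion (i : Fin d.N) : (relabelEach d P).motion i = (relabelMotion (P i), (d.motion i).2) :=
  rfl

/-- The relabelled background of label `i`. [folklore] -/
theorem relabelEach_background (i : Fin d.N) :
    (relabelEach d P).background i = boostedKerrBackground (relabelMotion (P i)) (d.motion i).2 (d.mass i) (d.spin i) :=
  rfl

/-- The relabelled chart of label `i` is `Ψᵢ ∘ Q̃ᵢ`. [folklore] -/
theorem relabelEach_chart (i : Fin d.N) :
    (relabelEach d P).chart i = relabelChart (P i) (d.motion i).2 (d.mass i) (d.spin i) (d.chart i) :=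
  rfl

/-- Same excisions. [folklore] -/
@[simp] theorem relabelEach_excision : (relabelEach d P).excision = d.excision := rfl

/-- Same initial time. [folklore] -/
@[simp] theorem relabelEach_τ₀ : (relabelEach d P).τ₀ = d.τ₀ := rfl

/-- Same flat domain. [folklore] -/
@[simp] theorem relabelEach_flatDomain : (relabelEach d P).flatDomain = d.flatDomain := rfl

/-- Same flat chart. [folklore] -/
@[simp] theorem relabelEach_flatChart : (relabelEach d P).flatChart = d.flatChart := rfl

/-- Same hole clocks. [folklore] -/
@[simp] theorem relabelEach_time (i : Fin d.N) :
    ((relabelEach d P).background i).time = (d.background i).time :=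
  boostedKerrBackground_relabelMotion_time _ _ _ _

/-- Same hole radii. [folklore] -/
@[simp] theorem relabelEach_radius (i : Fin d.N) :
    ((relabelEach d P).background i).radius = (d.background i).radius :=
  boostedKerrBackground_relabelMotion_radius _ _ _ _

/-- Same images of `(tᵢ, rᵢ, x⁰)`-defined model sets. [folklore] -/
theorem relabelEach_image_setOf (i : Fin d.N) (pr : ℝ → ℝ → ℝ → Prop) :
    (relabelEach d P).chart i '' {x | pr (((relabelEach d P).background i).time x.1)
        (((relabelEach d P).background i).radius x.1) (x.1 0)} =
      d.chart i '' {x | pr ((d.background i).time x.1) ((d.background i).radius x.1) (x.1 0)} :=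
  image_relabelChart_setOf _ _ _ _ (d.chart i) pr

/-- Same black-hole regions. [folklore] -/
theorem relabelEach_region (i : Fin d.N) : (relabelEach d P).region i = d.region i :=
  image_relabelChart_lateRegion _ _ _ _ (d.chart i) d.τ₀

/-- Same radiation zone. [folklore] -/
theorem relabelEach_radiationZone : (relabelEach d P).radiationZone = d.radiationZone := rfl

/-- **Same charted set** — hence the same exterior `exteriorOf 𝒟 d.charted`. [folklore] -/
theorem relabelEach_charted : (relabelEach d P).charted = d.charted := by
  simp only [FinalStateDecomposition.charted, relabelEach_radiationZone]
  congr 1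
  exact Set.iUnion_congr (relabelEach_region d P)

end Decomposition

/-! ### Transfer of the honest bundles -/

section Honest

variable {𝓢 : Spacetime.{0} 4} {O : Set 𝓢.carrier} {k : ℕ}
variable (d : FinalStateDecomposition 𝓢 O k) (P : ∀ i : Fin d.N, ParityDatum (d.motion i).1) (R₀ : ℝ)

/-- **`Hc` transfers verbatim**: orthochronicity by `(ΛQ)∂₀ = Λ∂₀`, the causal clauses (2)(3) are about images
of `(tᵢ, rᵢ)`-sets, (4) is about the unchanged flat chart. [folklore] -/
theorem honestCore_relabelEach (h : HonestCoreOf d R₀) : HonestCoreOf (relabelEach d P) R₀ := by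
  dsimp only [HonestCoreOf] at h ⊢
  obtain ⟨h1, h2, h3, h4⟩ := h
  refine ⟨fun i ↦ ⟨(h1 i).1, (h1 i).2.1, ?_⟩, fun i ϱ τ₂ hϱ hτ ↦ ?_, fun i τ' ϱ hϱ hτ ↦ ?_, h4⟩
  · show 0 < (((relabelMotion (P i) : lorentzGroup) : E4 ≃L[ℝ] E4) (E4.basisVector 0)) 0
    rw [relabelMotion_basisVector_zero]
    exact (h1 i).2.2
  · have e1 : (relabelEach d P).chart i '' {x | (relabelEach d P).τ₀ < ((relabelEach d P).background i).time x.1 ∧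
          ((relabelEach d P).background i).time x.1 < τ₂ ∧ ((relabelEach d P).background i).radius x.1 < ϱ} =
        d.chart i '' {x | d.τ₀ < (d.background i).time x.1 ∧ (d.background i).time x.1 < τ₂ ∧
          (d.background i).radius x.1 < ϱ} :=
      relabelEach_image_setOf d P i fun t r _ ↦ d.τ₀ < t ∧ t < τ₂ ∧ r < ϱ
    have e2 : (relabelEach d P).chart i '' ((relabelEach d P).background i).truncTimeSlab ϱ τ₂ =
        d.chart i '' (d.background i).truncTimeSlab ϱ τ₂ :=
      image_relabelChart_truncTimeSlab _ _ _ _ (d.chart i) ϱ τ₂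
    exact e1 ▸ e2 ▸ h2 i ϱ τ₂ hϱ hτ
  · have e1 : (relabelEach d P).chart i '' {x | τ' ≤ ((relabelEach d P).background i).time x.1 ∧
          ((relabelEach d P).background i).radius x.1 ≤ ϱ (((relabelEach d P).background i).time x.1)} =
        d.chart i '' {x | τ' ≤ (d.background i).time x.1 ∧
          (d.background i).radius x.1 ≤ ϱ ((d.background i).time x.1)} :=
      relabelEach_image_setOf d P i fun t r _ ↦ τ' ≤ t ∧ r ≤ ϱ t
    exact e1 ▸ h3 i τ' ϱ hϱ hτ

/-- **DV transfers** (`(ΛQ)∂₀ = Λ∂₀`). [folklore] -/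
theorem distinctLabels_relabelEach (h : DistinctLabels d) : DistinctLabels (relabelEach d P) := by
  intro i j hij heq
  refine h i j hij ?_
  have e : ∀ i, (((relabelEach d P).motion i).1 : E4 ≃L[ℝ] E4) (E4.basisVector 0) =
      ((d.motion i).1 : E4 ≃L[ℝ] E4) (E4.basisVector 0) := fun i ↦ relabelMotion_basisVector_zero (P i)
  rwa [e, e] at heq

/-- **`Hf` transfers from a `C⁰` bound over the REFLECTED honest cells** `Q̃ᵢ {T ≤ tᵢ, R₀ ≤ rᵢ ≤ rⱼ ∀ j ≠ i}`
(flat clauses (1)(2) verbatim — same flat chart, excisions and radii; (3) by the invariance of `C⁰` sup norms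
under `Q̃ᵢ`, `‖ΛᵢQᵢ‖ = ‖Λᵢ‖`).  For `d.N ≥ 2` the reflected cell is NOT the honest cell, and the hypothesis
is not a consequence of `HonestFarOf d R₀`. [folklore] -/
theorem honestFar_relabelEach (h : HonestFarOf d R₀)
    (h3 : ∀ i, ∃ T : ℝ, supCkENorm (Subtype.val '' (reflDom (P i) (d.motion i).2 (d.mass i) (d.spin i) ''
        {x : ((relabelEach d P).background i).domain | T ≤ ((relabelEach d P).background i).time x.1 ∧
          R₀ ≤ ((relabelEach d P).background i).radius x.1 ∧
          ∀ j, j ≠ i → ((relabelEach d P).background i).radius x.1 ≤ ((relabelEach d P).background j).radius x.1}))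
        0 (𝓢.deviationExtend (d.background i) (d.chart i)) ≤
      ENNReal.ofReal (1 / (10 * ‖(((d.motion i).1 : E4 ≃L[ℝ] E4) : E4 →L[ℝ] E4)‖ ^ 2))) :
    HonestFarOf (relabelEach d P) R₀ := by
  dsimp only [HonestFarOf] at h ⊢
  obtain ⟨h1, h2, _⟩ := h
  refine ⟨h1, fun τ' hτ ↦ ?_, fun i ↦ ?_⟩
  · simp only [relabelEach_radius]
    exact h2 τ' hτ
  · obtain ⟨T, hT⟩ := h3 i
    refine ⟨T, ?_⟩
    show supCkENorm _ 0 (𝓢.deviationExtend (boostedKerrBackground (relabelMotion (P i)) (d.motion i).2 (d.mass i)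
        (d.spin i)) (relabelChart (P i) (d.motion i).2 (d.mass i) (d.spin i) (d.chart i))) ≤
      ENNReal.ofReal (1 / (10 * ‖(((relabelMotion (P i) : lorentzGroup) : E4 ≃L[ℝ] E4) : E4 →L[ℝ] E4)‖ ^ 2))
    rw [norm_relabelMotion]
    exact (supCkENorm_deviationExtend_relabelChart (P i) _ _ _ (d.chart i) isOpen_univ (Set.subset_univ _)
      (fun x _ ↦ ((d.isLateChart i).contMDiff _).mdifferentiableAt (by simp)) 0).trans_le hT

/-- **For a single hole `Hf` transfers verbatim**: the Voronoi clause is vacuous and the cell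
`{T ≤ t, R₀ ≤ r}` is `Q̃`-invariant. [folklore] -/
theorem honestFar_relabelEach_of_N_eq_one (hN : d.N = 1) (h : HonestFarOf d R₀) :
    HonestFarOf (relabelEach d P) R₀ := by
  have hsub : Subsingleton (Fin d.N) := by rw [hN]; infer_instance
  have hs : ∀ i j : Fin d.N, j = i := fun i j ↦ Subsingleton.elim j i
  refine honestFar_relabelEach d P R₀ h fun i ↦ ?_
  have h3 : ∃ T : ℝ, supCkENorm (Subtype.val '' {x : (d.background i).domain | T ≤ (d.background i).time x.1 ∧
      R₀ ≤ (d.background i).radius x.1 ∧ ∀ j, j ≠ i → (d.background i).radius x.1 ≤ (d.background j).radius x.1})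
      0 (𝓢.deviationExtend (d.background i) (d.chart i)) ≤
      ENNReal.ofReal (1 / (10 * ‖(((d.motion i).1 : E4 ≃L[ℝ] E4) : E4 →L[ℝ] E4)‖ ^ 2)) := by
    dsimp only [HonestFarOf] at h
    exact h.2.2 i
  obtain ⟨T, hT⟩ := h3
  refine ⟨T, (congrArg (fun A ↦ supCkENorm (Subtype.val '' A) 0
    (𝓢.deviationExtend (d.background i) (d.chart i))) ?_).trans_le hT⟩
  refine image_reflDom_eq (P i) _ _ _ fun x ↦ ?_
  simp only [Set.mem_setOf_eq, FinalStateDecomposition.background, relabelEach_motion, relabelEach_mass,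
    relabelEach_spin, boostedKerrBackground_relabelMotion_time, boostedKerrBackground_relabelMotion_radius,
    reflDom_val, time_reflAffine, radius_reflAffine]
  exact ⟨fun h ↦ ⟨h.1, h.2.1, fun j hj ↦ absurd (hs i j) hj⟩, fun h ↦ ⟨h.1, h.2.1, fun j hj ↦ absurd (hs i j) hj⟩⟩

end Honest

/-! ### Transfer of single-label gap certificates -/

section Gap

variable {𝓢 : Spacetime.{0} 4} {O : Set 𝓢.carrier}

variable (d : FinalStateDecomposition 𝓢 O 4) (P : ∀ i : Fin d.N, ParityDatum (d.motion i).1) (R₀ : ℝ)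

/-- The `(t, r, x⁰)`-set `{τ₁ < t, r < W(x⁰) + 1}` of a boosted Kerr domain is open for continuous `W`. [folklore] -/
theorem isOpen_setOf_lt_time_radius_lt (Λ : lorentzGroup) (c : E4) (M a τ₁ : ℝ) {W : ℝ → ℝ}
    (hW : Continuous W) :
    IsOpen {x : (boostedKerrBackground Λ c M a).domain | τ₁ < (boostedKerrBackground Λ c M a).time x.1 ∧
      (boostedKerrBackground Λ c M a).radius x.1 < W (x.1 0) + 1} := by
  have h0 : Continuous fun y : E4 ↦ y 0 := PiLp.continuous_apply 2 _ 0
  have ht : Continuous (boostedKerrBackground Λ c M a).time := h0.comp (continuous_poincareInv Λ c)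
  have hr : Continuous (boostedKerrBackground Λ c M a).radius :=
    (Kerr.continuous_radius a).comp (continuous_poincareInv Λ c)
  refine IsOpen.preimage continuous_subtype_val (t := {y : E4 | τ₁ < (boostedKerrBackground Λ c M a).time y ∧
    (boostedKerrBackground Λ c M a).radius y < W (y 0) + 1}) ?_
  exact (isOpen_lt continuous_const ht).inter (isOpen_lt hr ((hW.comp h0).add continuous_const))

/-- A vector at which the time orientation is future-directed is the differential of a DIFFERENTIABLE map:
`IsFutureDirected (mfderiv f x v)` forces `MDifferentiableAt f x` (else `mfderiv = 0`). [folklore] -/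
theorem mdifferentiableAt_of_isFutureDirected_mfderiv {B : ModelBackground} {f : B.domain → 𝓢.carrier}
    {x : B.domain} {v : E4}
    (h : 𝓢.timeOrientation.IsFutureDirected (mfderiv 𝓘(ℝ, E4) (𝓡 4) f x v)) :
    MDifferentiableAt 𝓘(ℝ, E4) (𝓡 4) f x := by
  by_contra hx
  have h0 : mfderiv 𝓘(ℝ, E4) (𝓡 4) f x v = 0 := by
    rw [mfderiv_zero_of_not_mdifferentiableAt hx]; rfl
  rw [h0] at h
  exact (lt_irrefl (0 : ℝ)) (by simpa using h.2)

/-- **Single-label gap certificates transfer** to `relabelEach d P` (hypothesis and conclusion are VERBATIM the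
skeleton's `GapCertificateAt 𝓢 O d R₀ i w` / `GapCertificateAt 𝓢 O (relabelEach d P) R₀ i w`), with the same
constants and the relabelled gap chart `Ψg ∘ Q̃ᵢ` (G2 by the chart-transfer bricks on `U = Q̃ᵢ⁻¹U`, the pin clause and G5 by
`Q̃ᵢ`-invariance of `(t, r, x⁰)`-sets, G3 by invariance of `C²` sup norms, G4 by
`d(Ψg ∘ Q̃ᵢ)((ΛQ)∂₀) = dΨg(Λ∂₀)`). [folklore] -/
theorem gapCertificateAt_relabelEach (i : Fin d.N) (w : ℝ → ℝ)
    (h : ∃ (R₁ τ₁ : ℝ) (W : ℝ → ℝ) (Ψg : (d.background i).domain → 𝓢.carrier),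
      let B := d.background i; let t := B.time; let r := B.radius;
      R₀ ≤ R₁ ∧ d.τ₀ ≤ τ₁ ∧ Continuous W ∧ (∀ s, τ₁ ≤ s → w s ≤ W s) ∧
      (let U : Set B.domain := {x | τ₁ < t x.1 ∧ r x.1 < W (x.1 0) + 1};
        ContMDiffOn 𝓘(ℝ, E4) (𝓡 4) ∞ Ψg U ∧ Topology.IsOpenEmbedding (U.restrict Ψg) ∧ Ψg '' U ⊆ d.charted) ∧
      (∀ x : B.domain, r x.1 ≤ R₁ + 1 → Ψg x = d.chart i x) ∧
      Tendsto (fun τ ↦ supCkENorm (Subtype.val '' {x : B.domain | t x.1 = τ ∧ r x.1 ≤ W (x.1 0)}) 2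
        (𝓢.deviationExtend B Ψg)) atTop (𝓝 0) ∧
      (∀ x : B.domain, τ₁ ≤ t x.1 → R₁ ≤ r x.1 → r x.1 ≤ W (x.1 0) →
        𝓢.timeOrientation.IsFutureDirected
          (mfderiv 𝓘(ℝ, E4) (𝓡 4) Ψg x (((d.motion i).1 : E4 ≃L[ℝ] E4) (E4.basisVector 0)))) ∧
      (∀ (τ' : ℝ) (ϱ : ℝ → ℝ), Continuous ϱ → τ₁ < τ' →
        (∀ x : B.domain, τ' ≤ t x.1 → r x.1 ≤ ϱ (t x.1) → r x.1 ≤ W (x.1 0)) →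
        closure (Ψg '' {x | τ' ≤ t x.1 ∧ r x.1 ≤ ϱ (t x.1)}) ∩ O ⊆ Ψg '' {x | τ' ≤ t x.1 ∧ r x.1 ≤ ϱ (t x.1)})) :
    ∃ (R₁ τ₁ : ℝ) (W : ℝ → ℝ) (Ψg : ((relabelEach d P).background i).domain → 𝓢.carrier),
      let B := (relabelEach d P).background i; let t := B.time; let r := B.radius;
      R₀ ≤ R₁ ∧ (relabelEach d P).τ₀ ≤ τ₁ ∧ Continuous W ∧ (∀ s, τ₁ ≤ s → w s ≤ W s) ∧
      (let U : Set B.domain := {x | τ₁ < t x.1 ∧ r x.1 < W (x.1 0) + 1};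
        ContMDiffOn 𝓘(ℝ, E4) (𝓡 4) ∞ Ψg U ∧ Topology.IsOpenEmbedding (U.restrict Ψg) ∧
          Ψg '' U ⊆ (relabelEach d P).charted) ∧
      (∀ x : B.domain, r x.1 ≤ R₁ + 1 → Ψg x = (relabelEach d P).chart i x) ∧
      Tendsto (fun τ ↦ supCkENorm (Subtype.val '' {x : B.domain | t x.1 = τ ∧ r x.1 ≤ W (x.1 0)}) 2
        (𝓢.deviationExtend B Ψg)) atTop (𝓝 0) ∧
      (∀ x : B.domain, τ₁ ≤ t x.1 → R₁ ≤ r x.1 → r x.1 ≤ W (x.1 0) →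
        𝓢.timeOrientation.IsFutureDirected
          (mfderiv 𝓘(ℝ, E4) (𝓡 4) Ψg x ((((relabelEach d P).motion i).1 : E4 ≃L[ℝ] E4) (E4.basisVector 0)))) ∧
      (∀ (τ' : ℝ) (ϱ : ℝ → ℝ), Continuous ϱ → τ₁ < τ' →
        (∀ x : B.domain, τ' ≤ t x.1 → r x.1 ≤ ϱ (t x.1) → r x.1 ≤ W (x.1 0)) →
        closure (Ψg '' {x | τ' ≤ t x.1 ∧ r x.1 ≤ ϱ (t x.1)}) ∩ O ⊆ Ψg '' {x | τ' ≤ t x.1 ∧ r x.1 ≤ ϱ (t x.1)}) := by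
  simp only [FinalStateDecomposition.background, relabelEach_motion, relabelEach_chart,
    relabelEach_mass, relabelEach_spin, relabelEach_τ₀, relabelEach_charted] at h ⊢
  obtain ⟨R₁, τ₁, W, Ψg, hR, hτ, hW, hwall, ⟨hG2a, hG2b, hG2c⟩, hpin, hG3, hG4, hG5⟩ := h
  have hU := isOpen_setOf_lt_time_radius_lt (d.motion i).1 (d.motion i).2 (d.mass i) (d.spin i) τ₁ hW
  have hpre := preimage_reflDom_setOf (P i) (d.motion i).2 (d.mass i) (d.spin i) (fun t r s ↦ τ₁ < t ∧ r < W s + 1)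
  refine ⟨R₁, τ₁, W, relabelChart (P i) _ _ _ Ψg, hR, hτ, hW, hwall, ⟨?_, ?_, ?_⟩, ?_, ?_, ?_, ?_⟩
  · have key := contMDiffOn_relabelChart (P i) _ _ _ Ψg hG2a
    rw [hpre] at key
    exact key
  · have key := isOpenEmbedding_restrict_relabelChart (P i) _ _ _ Ψg hG2b
    rw [hpre] at key
    exact key
  · rw [image_relabelChart_setOf (P i) _ _ _ Ψg (fun t r s ↦ τ₁ < t ∧ r < W s + 1)]
    exact hG2c
  · intro x hx
    exact relabelChart_eq_of_eq (P i) _ _ _ (d.chart i) (Ψg := Ψg) (fun _ r _ ↦ r ≤ R₁ + 1) hpin x hx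
  · refine hG3.congr' ?_
    filter_upwards [eventually_gt_atTop τ₁] with τ hτ₁
    exact (supCkENorm_deviationExtend_relabelChart_setOf (P i) _ _ _ Ψg (fun t r s ↦ τ₁ < t ∧ r < W s + 1)
      (fun t r s ↦ t = τ ∧ r ≤ W s) hU (fun t r s hs ↦ ⟨hs.1 ▸ hτ₁, by linarith [hs.2]⟩) hG2a 2).symm
  · intro x ht hr hrW
    simp only [boostedKerrBackground_relabelMotion_time, boostedKerrBackground_relabelMotion_radius] at ht hr hrW
    have hd := hG4 (reflDom (P i) _ _ _ x) (by simpa using ht) (by simpa using hr) (by simpa using hrW)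
    have key : 𝓢.timeOrientation.IsFutureDirected (mfderiv 𝓘(ℝ, E4) (𝓡 4)
        (relabelChart (P i) (d.motion i).2 (d.mass i) (d.spin i) Ψg) x
        (((relabelMotion (P i) : lorentzGroup) : E4 ≃L[ℝ] E4) (E4.basisVector 0))) := by
      rw [mfderiv_relabelChart_motion_basisVector_zero (P i) _ _ _ Ψg x
        (mdifferentiableAt_of_isFutureDirected_mfderiv hd)]
      exact hd
    exact key
  · intro τ' ϱ hϱ hτ' hϱW
    rw [image_relabelChart_setOf (P i) _ _ _ Ψg (fun t r _ ↦ τ' ≤ t ∧ r ≤ ϱ t)]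
    refine hG5 τ' ϱ hϱ hτ' fun x hxt hxr ↦ ?_
    have h := hϱW (reflDom' (P i) _ _ _ x)
    simp only [reflDom'_val, time_reflAffine, radius_reflAffine, reflAffine_apply_zero,
      boostedKerrBackground_relabelMotion_time, boostedKerrBackground_relabelMotion_radius] at h
    exact h hxt hxr

end Gap

/-! ### Registered brick -/

section Brick

variable {𝓢 : Spacetime.{0} 4} {O : Set 𝓢.carrier} {k : ℕ}

/-- **Registered brick `stub_parityRelabelDecomposition`** (definition-free summary of `relabelEach`): for
every family of Lorentz involutions `Qᵢ` fixing `∂₀`, `Λᵢ⁻¹∂₀` and `x³` there is a decomposition of the same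
region with the same charted set, flat domain, flat chart, `τ₀`, excisions, labels `(ΛᵢQᵢ, cᵢ)`, honest core
and distinct velocities preserved, whose hole charts have the same images of all `(tᵢ, rᵢ, x⁰)`-sets. [folklore] -/
theorem stub_parityRelabelDecomposition {𝓢 : Spacetime.{0} 4} {O : Set 𝓢.carrier} {k : ℕ}
    (d : FinalStateDecomposition 𝓢 O k) (R₀ : ℝ) (Q : Fin d.N → lorentzGroup)
    (hQQ : ∀ i v, (Q i : E4 ≃L[ℝ] E4) ((Q i : E4 ≃L[ℝ] E4) v) = v)
    (hQ0 : ∀ i, (Q i : E4 ≃L[ℝ] E4) (E4.basisVector 0) = E4.basisVector 0)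
    (hQu : ∀ i, (Q i : E4 ≃L[ℝ] E4) (((d.motion i).1 : E4 ≃L[ℝ] E4).symm (E4.basisVector 0)) =
      ((d.motion i).1 : E4 ≃L[ℝ] E4).symm (E4.basisVector 0))
    (hQ3 : ∀ i v, (Q i : E4 ≃L[ℝ] E4) v 3 = v 3)
    (hc : Theorems.GapDecaySuffices.Negative.Relabel.HonestCoreOf d R₀)
    (hdv : Theorems.GapDecaySuffices.Negative.Relabel.DistinctLabels d) :
    ∃ d' : FinalStateDecomposition 𝓢 O k, d'.charted = d.charted ∧ d'.flatDomain = d.flatDomain ∧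
      d'.τ₀ = d.τ₀ ∧
      (∀ (y : E4) (hy : y ∈ d.flatDomain) (hy' : y ∈ d'.flatDomain), d'.flatChart ⟨y, hy'⟩ = d.flatChart ⟨y, hy⟩) ∧
      Theorems.GapDecaySuffices.Negative.Relabel.HonestCoreOf d' R₀ ∧
      Theorems.GapDecaySuffices.Negative.Relabel.DistinctLabels d' ∧
      ∃ e : d'.N = d.N, ∀ i : Fin d'.N,
        d'.motion i = ((d.motion (Fin.cast e i)).1 * Q (Fin.cast e i), (d.motion (Fin.cast e i)).2) ∧
        d'.excision i = d.excision (Fin.cast e i) ∧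
        ∀ pr : ℝ → ℝ → ℝ → Prop,
          d'.chart i '' {x | pr ((d'.background i).time x.1) ((d'.background i).radius x.1) (x.1 0)} =
            d.chart (Fin.cast e i) '' {x | pr ((d.background (Fin.cast e i)).time x.1)
              ((d.background (Fin.cast e i)).radius x.1) (x.1 0)} := by
  let P : ∀ i : Fin d.N, ParityDatum (d.motion i).1 := fun i ↦ ⟨Q i, hQQ i, hQ0 i, hQu i, hQ3 i⟩
  exact ⟨relabelEach d P, relabelEach_charted d P, rfl, rfl, fun _ _ _ ↦ rfl, honestCore_relabelEach d P R₀ hc,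
    distinctLabels_relabelEach d P hdv, rfl, fun i ↦ ⟨rfl, rfl, fun pr ↦ relabelEach_image_setOf d P i pr⟩⟩

end Brick

end Summit.FinalStateConjecture.FinalStateConjecture.Theorems.GapDecaySuffices.Relabel
end
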